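import Summits.QuantumFields.BalabanUV.Beta.GAN24.Push3

/-!
# `BalabanUV.Beta.GAN24.Push3Relabel` — binder row G-an2-4 / (CONV-C), W-slot CT-W, route «WC-TL» ∕ «QR-LL», (S) row sub-row (S-τ) of the OWNER gan24-p1 g27's
# RULING R-gan24p1-g27-1 PART A (iv) (journal l.41413: «(S-τ)_{j+1} ⇐ (INV)_j ∧ the S-step push is inversion-covariant — one generic lemma on `push₃` under
# `refK`-type maps, leaf-01∕leaf-03 currency; statement wanted»; A1 l.41457: O-leaf01-g64-1 WANTED): THE THREE-LEG PUSH COMMUTES WITH LATTICE RELABELLINGS —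
# joint block translations (summability-free) and general two-scale leg relabellings with signs (`KernelReflection.LegMap` currency: one bijection + one sign per
# 1-form index type, here per DIRECTION, separately on the coarse (output) and the fine (input) lattice)

NOT IN PRINT; OUR BOOKKEEPING ([folklore] `tsum` re-indexings under `Push3.push₃_inl_inl`, the pattern of `KernelReflection.comp_refK`; G-an2-4 formalisation swarm, leaf prover
`b2b-balaban-gan24-formalise-leaf-01`, gen 64).  HONEST FRAMING (cell contract, verbatim): «discharging `BetaPertH` makes Bałaban's UV stability UNCONDITIONAL — a real
constructive-QFT result; it is NOT the continuum limit and NOT the Clay problem.»  HONEST DEPENDENCY (verbatim): «continuum YM on T⁴ ⇐ BetaPertH ∧ nine spine estimates (0/9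
proved); BetaPertH ⇐ (D1) ∧ (D4) ∧ CAP+tail; G-an2-4 gates asym, D1 and NE2/3/4.»

## What (generic `d`; GENERIC legs ∕ letter families; no object of an2's typed system occurs)
§1 TRANSLATIONS (no summability needed — the shift is direction-independent): `vertexW_translate`, **`push₃_translate`**: legs jointly block-translation covariant
   (`l α (x′ + v) κ (x + N•v) = l α x′ κ x`, same for `r`, `w`) carry a translated letter family `S′ κ (u + N•v) (x + N•v) (z + N•v) = S κ u x z` to the translated push
   `push₃ l r w S′ ν (U + v) (x′ + v) (z′ + v) a b = push₃ l r w S ν U x′ z′ a b`; `push₃_translate_family` (label-indexed families).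
§2 GENERAL TWO-SCALE RELABELLINGS WITH SIGNS (three slice-summability binders, as `KernelReflection.comp_refK`): per direction `κ` a bijection `rF κ` of the fine
   lattice with sign `sF κ` and a bijection `rC κ` of the coarse lattice with sign `sC κ`, `sF κ·sF κ = 1`; legs covariant `l α (rC α x′) κ (rF κ x) = sC α·sF κ·l α x′ κ x`
   (same `r`, `w`); letter family covariant on its ff block `S′ k (rF k u) (rF κ₁ x) (rF κ₂ z) κ₁κ₂ = sF k·sF κ₁·sF κ₂·S k u x z κ₁κ₂` ⇒ **`push₃_relabel_inl_inl`**: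
   `push₃ l r w S′ ν (rC ν U) (rC α x′) (rC β z′) (inl α)(inl β) = sC ν·sC α·sC β·push₃ l r w S ν U x′ z′ (inl α)(inl β)` — the pushed family is covariant with the COARSE
   data, the fine signs square away index by index (the point inversion through a label composed with the bond flip, `rF κ x = c − x − e_κ`, `sF = −1`, is the (INV)
   instance of R14; the axis reflections `KernelReflection.bondRefl` another).
§3 **`tsum_tsum_push₃_relabel`** — THE ff CHARGE PROFILE OF THE PUSHED FAMILY IS COVARIANT: `Σ'_{x′} Σ'_{z′} push₃ l r w S′ ν (rC ν U) x′ z′ (inl α)(inl β)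
   = sC ν·sC α·sC β·Σ'_{x′} Σ'_{z′} push₃ l r w S ν U x′ z′ (inl α)(inl β)` (two more re-indexings, no further summability) — the (S-τ) recursion's input: an
   inversion-covariant letter family pushed through inversion-covariant legs has an inversion-covariant charge profile (signs as displayed; with `SlotMomentParity` this is
   «zero label-moments in, zero label-moments out» once (M0) is supplied).
[folklore]; 0 cited facts, 0 `def`, 0 `def … : Prop`, 0 sorry.  Asserts NOTHING about which legs ∕ letters are covariant ((INV-G)∕(INV-T)∕(INV-ω): an2∕an1∕leaf-09∕p2 custodians
by name, E22); NEVER «G-an2-4 closed» as (CONV-C); NOT D1, NOT `BetaPertH`, NOT continuum, NOT Clay.  2026-08-22.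
-/

noncomputable section

open Finset
open scoped BigOperators
open Literature.MathematicalPhysics.QuantumFieldTheory
open Literature.MathematicalPhysics.QuantumFieldTheory.Balaban1983to89
open Literature.MathematicalPhysics.QuantumFieldTheory.Balaban1983to89.Beta
open ExpKernelCalculus (MKer)
open OneStepResolventKernel (Fib)
open Summit.QuantumFields.BalabanUV.Beta.GAN24.Push4 (vertexW vertexW_apply ffRead ffRead_inr_left ffRead_inr_right)
open Summit.QuantumFields.BalabanUV.Beta.GAN24.Push3 (push₃ push₃_inl_inl push₃_def)

namespace Summit.QuantumFields.BalabanUV.Beta.GAN24.Push3Relabel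

variable {d : ℕ}

/-! ## §1 Joint block translations -/

section Translate

variable {N : ℕ} {v : Fin (d + 1) → ℤ}
  {l r w : Fin (d + 1) → (Fin (d + 1) → ℤ) → Fin (d + 1) → (Fin (d + 1) → ℤ) → ℝ}
  (hl : ∀ α x' κ x, l α (x' + v) κ (x + (N : ℤ) • v) = l α x' κ x)
  (hr : ∀ β z' κ z, r β (z' + v) κ (z + (N : ℤ) • v) = r β z' κ z)
  (hw : ∀ ν U κ u, w ν (U + v) κ (u + (N : ℤ) • v) = w ν U κ u)

include hw in
/-- [folklore] The table vertex of a translated family through a covariant table leg is the translated table vertex. -/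
theorem vertexW_translate {S S' : Fin (d + 1) → (Fin (d + 1) → ℤ) → MKer (d + 1) (Fib d)}
    (hS : ∀ κ u x z a b, S' κ (u + (N : ℤ) • v) (x + (N : ℤ) • v) (z + (N : ℤ) • v) a b = S κ u x z a b)
    (ν : Fin (d + 1)) (U x z : Fin (d + 1) → ℤ) (a b : Fib d) :
    vertexW w S' ν (U + v) (x + (N : ℤ) • v) (z + (N : ℤ) • v) a b = vertexW w S ν U x z a b := by
  rw [vertexW_apply, vertexW_apply]
  refine Finset.sum_congr rfl fun κ _ => ?_
  rw [← (Equiv.addRight ((N : ℤ) • v)).tsum_eq]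
  refine tsum_congr fun u => ?_
  simp only [Equiv.coe_addRight]
  rw [hw, hS]

include hl hr hw in
/-- NOT IN PRINT; OUR BOOKKEEPING.  **THE THREE-LEG PUSH IS JOINTLY BLOCK-TRANSLATION COVARIANT**: covariant legs (coarse index by `v`, fine index by `N•v`) carry a
translated letter family to the translated push — `push₃ l r w S′ ν (U + v) (x′ + v) (z′ + v) a b = push₃ l r w S ν U x′ z′ a b`; no summability is needed (the shift does
not depend on the direction index). -/
theorem push₃_translate {S S' : Fin (d + 1) → (Fin (d + 1) → ℤ) → MKer (d + 1) (Fib d)}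
    (hS : ∀ κ u x z a b, S' κ (u + (N : ℤ) • v) (x + (N : ℤ) • v) (z + (N : ℤ) • v) a b = S κ u x z a b)
    (ν : Fin (d + 1)) (U x' z' : Fin (d + 1) → ℤ) (a b : Fib d) :
    push₃ l r w S' ν (U + v) (x' + v) (z' + v) a b = push₃ l r w S ν U x' z' a b := by
  rcases a with α | μ
  · rcases b with β | μ'
    · rw [push₃_inl_inl, push₃_inl_inl, ← (Equiv.addRight ((N : ℤ) • v)).tsum_eq]
      refine tsum_congr fun z => ?_
      simp only [Equiv.coe_addRight]
      refine Finset.sum_congr rfl fun κ₂ _ => ?_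
      rw [hr]
      congr 1
      rw [← (Equiv.addRight ((N : ℤ) • v)).tsum_eq]
      refine tsum_congr fun x => ?_
      simp only [Equiv.coe_addRight]
      refine Finset.sum_congr rfl fun κ₁ _ => ?_
      rw [hl, vertexW_translate hw hS]
    · rw [push₃_def, push₃_def, ffRead_inr_right, ffRead_inr_right]
  · rw [push₃_def, push₃_def, ffRead_inr_left, ffRead_inr_left]

include hl hr hw in
/-- NOT IN PRINT; OUR BOOKKEEPING.  **LABEL COVARIANCE OF THE PUSHED FAMILY**: a label-indexed letter family `X y`, covariant under `y ↦ y + v` jointly with the `N•v`-shift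
of its slot and kernel indices, is carried to a family covariant under `y ↦ y + v` jointly with the COARSE `v`-shift of the output indices. -/
theorem push₃_translate_family {ι : Type*} [Add ι] {X : ι → Fin (d + 1) → (Fin (d + 1) → ℤ) → MKer (d + 1) (Fib d)} {y vι : ι}
    (hX : ∀ κ u x z a b, X (y + vι) κ (u + (N : ℤ) • v) (x + (N : ℤ) • v) (z + (N : ℤ) • v) a b = X y κ u x z a b)
    (ν : Fin (d + 1)) (U x' z' : Fin (d + 1) → ℤ) (a b : Fib d) :
    push₃ l r w (X (y + vι)) ν (U + v) (x' + v) (z' + v) a b = push₃ l r w (X y) ν U x' z' a b :=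
  push₃_translate hl hr hw hX ν U x' z' a b

end Translate

/-! ## §2 General two-scale relabellings with signs -/

section Relabel

variable {rF rC : Fin (d + 1) → (Fin (d + 1) → ℤ) ≃ (Fin (d + 1) → ℤ)} {sF sC : Fin (d + 1) → ℝ}
  {l r w : Fin (d + 1) → (Fin (d + 1) → ℤ) → Fin (d + 1) → (Fin (d + 1) → ℤ) → ℝ}
  {S S' : Fin (d + 1) → (Fin (d + 1) → ℤ) → MKer (d + 1) (Fib d)}
  (hsF : ∀ κ, sF κ * sF κ = 1)
  (hl : ∀ α x' κ x, l α (rC α x') κ (rF κ x) = sC α * sF κ * l α x' κ x)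
  (hr : ∀ β z' κ z, r β (rC β z') κ (rF κ z) = sC β * sF κ * r β z' κ z)
  (hw : ∀ ν U κ u, w ν (rC ν U) κ (rF κ u) = sC ν * sF κ * w ν U κ u)
  (hS : ∀ k u x z κ₁ κ₂, S' k (rF k u) (rF κ₁ x) (rF κ₂ z) (Sum.inl κ₁) (Sum.inl κ₂) = sF k * sF κ₁ * sF κ₂ * S k u x z (Sum.inl κ₁) (Sum.inl κ₂))
  (hws : ∀ ν U κ x z κ₁ κ₂, Summable fun u : Fin (d + 1) → ℤ => w ν U κ u * S κ u x z (Sum.inl κ₁) (Sum.inl κ₂))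
  (hls : ∀ α x' κ₁ ν U z κ₂, Summable fun x : Fin (d + 1) → ℤ => l α x' κ₁ x * vertexW w S ν U x z (Sum.inl κ₁) (Sum.inl κ₂))
  (hrs : ∀ α x' β z' ν U κ₂, Summable fun z : Fin (d + 1) → ℤ =>
    (∑' x : Fin (d + 1) → ℤ, ∑ κ₁ : Fin (d + 1), l α x' κ₁ x * vertexW w S ν U x z (Sum.inl κ₁) (Sum.inl κ₂)) * r β z' κ₂ z)

include hsF hw hS hws in
/-- [folklore] **THE TABLE VERTEX IS COVARIANT** (slot re-indexed direction by direction; the slot's fine sign squares away):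
`vertexW w S′ ν (rC ν U) (rF κ₁ x) (rF κ₂ z) κ₁κ₂ = sC ν·sF κ₁·sF κ₂·vertexW w S ν U x z κ₁κ₂`. -/
theorem vertexW_relabel_inl_inl (ν : Fin (d + 1)) (U x z : Fin (d + 1) → ℤ) (κ₁ κ₂ : Fin (d + 1)) :
    vertexW w S' ν (rC ν U) (rF κ₁ x) (rF κ₂ z) (Sum.inl κ₁) (Sum.inl κ₂)
      = sC ν * sF κ₁ * sF κ₂ * vertexW w S ν U x z (Sum.inl κ₁) (Sum.inl κ₂) := by
  rw [vertexW_apply, vertexW_apply, Finset.mul_sum]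
  refine Finset.sum_congr rfl fun κ _ => ?_
  have hs' : Summable fun u : Fin (d + 1) → ℤ => w ν U κ (rF κ u) * S κ (rF κ u) x z (Sum.inl κ₁) (Sum.inl κ₂) :=
    (rF κ).summable_iff.2 (hws ν U κ x z κ₁ κ₂)
  rw [← (rF κ).tsum_eq (fun u => w ν (rC ν U) κ u * S' κ u (rF κ₁ x) (rF κ₂ z) (Sum.inl κ₁) (Sum.inl κ₂)), ← tsum_mul_left]
  refine tsum_congr fun u => ?_
  rw [hw, hS]
  have hk := hsF κ
  calc sC ν * sF κ * w ν U κ u * (sF κ * sF κ₁ * sF κ₂ * S κ u x z (Sum.inl κ₁) (Sum.inl κ₂))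
      = (sF κ * sF κ) * (sC ν * sF κ₁ * sF κ₂ * (w ν U κ u * S κ u x z (Sum.inl κ₁) (Sum.inl κ₂))) := by ring
    _ = _ := by rw [hk, one_mul]

/-- [folklore] A re-indexed series with a constant factor: `G (e x) = c·F x` for a bijection `e` ⇒ `Σ' G = c·Σ' F`. -/
theorem tsum_relabel_mul (e : (Fin (d + 1) → ℤ) ≃ (Fin (d + 1) → ℤ)) (F G : (Fin (d + 1) → ℤ) → ℝ) (c : ℝ) (h : ∀ x, G (e x) = c * F x) :
    ∑' x, G x = c * ∑' x, F x := by
  rw [← e.tsum_eq G, ← tsum_mul_left]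
  exact tsum_congr h

/-- [folklore] … and its summability transfers: `Summable F ⇒ Summable G`. -/
theorem summable_relabel_mul (e : (Fin (d + 1) → ℤ) ≃ (Fin (d + 1) → ℤ)) (F G : (Fin (d + 1) → ℤ) → ℝ) (c : ℝ) (h : ∀ x, G (e x) = c * F x)
    (hF : Summable F) : Summable G :=
  e.summable_iff.1 ((hF.mul_left c).congr fun x => (h x).symm)

include hsF hl hr hw hS hws hls hrs in
/-- NOT IN PRINT; OUR BOOKKEEPING (`Push3.push₃_inl_inl` ⨾ the `z`-sum exchanged with the finite `κ₂`-sum and re-indexed by `rF κ₂`, the `x`-sum by `rF κ₁`, the slot sum by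
`rF k` — the pattern of `KernelReflection.comp_refK`, leg type by leg type).  **THE THREE-LEG PUSH IS COVARIANT UNDER TWO-SCALE LEG RELABELLINGS**: with the hypotheses of
this section, `push₃ l r w S′ ν (rC ν U) (rC α x′) (rC β z′) (inl α)(inl β) = sC ν·sC α·sC β·push₃ l r w S ν U x′ z′ (inl α)(inl β)` — every fine sign squares away on
its own index, the pushed family transforms with the COARSE data like a letter family with the three 1-form indices `ν, α, β`. -/
theorem push₃_relabel_inl_inl (ν : Fin (d + 1)) (U x' z' : Fin (d + 1) → ℤ) (α β : Fin (d + 1)) :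
    push₃ l r w S' ν (rC ν U) (rC α x') (rC β z') (Sum.inl α) (Sum.inl β)
      = sC ν * sC α * sC β * push₃ l r w S ν U x' z' (Sum.inl α) (Sum.inl β) := by
  -- the inner `x`-layer, relabelled direction by direction
  have hinner : ∀ z κ₂, (∑' x : Fin (d + 1) → ℤ, ∑ κ₁ : Fin (d + 1), l α (rC α x') κ₁ x * vertexW w S' ν (rC ν U) x (rF κ₂ z) (Sum.inl κ₁) (Sum.inl κ₂))
      = sC α * sC ν * sF κ₂ * ∑' x : Fin (d + 1) → ℤ, ∑ κ₁ : Fin (d + 1), l α x' κ₁ x * vertexW w S ν U x z (Sum.inl κ₁) (Sum.inl κ₂) := by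
    intro z κ₂
    have hs1 : ∀ κ₁, Summable fun x : Fin (d + 1) → ℤ => l α x' κ₁ x * vertexW w S ν U x z (Sum.inl κ₁) (Sum.inl κ₂) :=
      fun κ₁ => hls α x' κ₁ ν U z κ₂
    have hterm : ∀ κ₁ x, l α (rC α x') κ₁ (rF κ₁ x) * vertexW w S' ν (rC ν U) (rF κ₁ x) (rF κ₂ z) (Sum.inl κ₁) (Sum.inl κ₂)
        = sC α * sC ν * sF κ₂ * (l α x' κ₁ x * vertexW w S ν U x z (Sum.inl κ₁) (Sum.inl κ₂)) := by
      intro κ₁ x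
      rw [hl, vertexW_relabel_inl_inl hsF hw hS hws]
      have hk := hsF κ₁
      calc sC α * sF κ₁ * l α x' κ₁ x * (sC ν * sF κ₁ * sF κ₂ * vertexW w S ν U x z (Sum.inl κ₁) (Sum.inl κ₂))
          = (sF κ₁ * sF κ₁) * (sC α * sC ν * sF κ₂ * (l α x' κ₁ x * vertexW w S ν U x z (Sum.inl κ₁) (Sum.inl κ₂))) := by ring
        _ = _ := by rw [hk, one_mul]
    have hs3 : ∀ κ₁, Summable fun x : Fin (d + 1) → ℤ => l α (rC α x') κ₁ x * vertexW w S' ν (rC ν U) x (rF κ₂ z) (Sum.inl κ₁) (Sum.inl κ₂) :=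
      fun κ₁ => summable_relabel_mul (rF κ₁) (fun x => l α x' κ₁ x * vertexW w S ν U x z (Sum.inl κ₁) (Sum.inl κ₂))
        (fun x => l α (rC α x') κ₁ x * vertexW w S' ν (rC ν U) x (rF κ₂ z) (Sum.inl κ₁) (Sum.inl κ₂)) _ (hterm κ₁) (hs1 κ₁)
    rw [Summable.tsum_finsetSum (fun κ₁ _ => hs3 κ₁), Summable.tsum_finsetSum (fun κ₁ _ => hs1 κ₁), Finset.mul_sum]
    refine Finset.sum_congr rfl fun κ₁ _ => ?_
    exact tsum_relabel_mul (rF κ₁) (fun x => l α x' κ₁ x * vertexW w S ν U x z (Sum.inl κ₁) (Sum.inl κ₂))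
      (fun x => l α (rC α x') κ₁ x * vertexW w S' ν (rC ν U) x (rF κ₂ z) (Sum.inl κ₁) (Sum.inl κ₂)) _ (hterm κ₁)
  -- the outer `z`-layer
  have hz1 : ∀ κ₂, Summable fun z : Fin (d + 1) → ℤ =>
      (∑' x : Fin (d + 1) → ℤ, ∑ κ₁ : Fin (d + 1), l α x' κ₁ x * vertexW w S ν U x z (Sum.inl κ₁) (Sum.inl κ₂)) * r β z' κ₂ z :=
    fun κ₂ => hrs α x' β z' ν U κ₂
  have hzterm : ∀ κ₂ z, (∑' x : Fin (d + 1) → ℤ, ∑ κ₁ : Fin (d + 1), l α (rC α x') κ₁ x * vertexW w S' ν (rC ν U) x (rF κ₂ z) (Sum.inl κ₁) (Sum.inl κ₂))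
        * r β (rC β z') κ₂ (rF κ₂ z)
      = sC ν * sC α * sC β * ((∑' x : Fin (d + 1) → ℤ, ∑ κ₁ : Fin (d + 1), l α x' κ₁ x * vertexW w S ν U x z (Sum.inl κ₁) (Sum.inl κ₂)) * r β z' κ₂ z) := by
    intro κ₂ z
    rw [hinner, hr]
    have hk := hsF κ₂
    calc sC α * sC ν * sF κ₂ * (∑' x : Fin (d + 1) → ℤ, ∑ κ₁ : Fin (d + 1), l α x' κ₁ x * vertexW w S ν U x z (Sum.inl κ₁) (Sum.inl κ₂))
          * (sC β * sF κ₂ * r β z' κ₂ z)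
        = (sF κ₂ * sF κ₂) * (sC ν * sC α * sC β * ((∑' x : Fin (d + 1) → ℤ, ∑ κ₁ : Fin (d + 1), l α x' κ₁ x * vertexW w S ν U x z (Sum.inl κ₁) (Sum.inl κ₂))
          * r β z' κ₂ z)) := by ring
      _ = _ := by rw [hk, one_mul]
  have hz2 : ∀ κ₂, Summable fun z : Fin (d + 1) → ℤ =>
      (∑' x : Fin (d + 1) → ℤ, ∑ κ₁ : Fin (d + 1), l α (rC α x') κ₁ x * vertexW w S' ν (rC ν U) x z (Sum.inl κ₁) (Sum.inl κ₂)) * r β (rC β z') κ₂ z :=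
    fun κ₂ => summable_relabel_mul (rF κ₂)
      (fun z => (∑' x : Fin (d + 1) → ℤ, ∑ κ₁ : Fin (d + 1), l α x' κ₁ x * vertexW w S ν U x z (Sum.inl κ₁) (Sum.inl κ₂)) * r β z' κ₂ z)
      (fun z => (∑' x : Fin (d + 1) → ℤ, ∑ κ₁ : Fin (d + 1), l α (rC α x') κ₁ x * vertexW w S' ν (rC ν U) x z (Sum.inl κ₁) (Sum.inl κ₂)) * r β (rC β z') κ₂ z)
      _ (hzterm κ₂) (hz1 κ₂)
  rw [push₃_inl_inl, push₃_inl_inl, Summable.tsum_finsetSum (fun κ₂ _ => hz2 κ₂), Summable.tsum_finsetSum (fun κ₂ _ => hz1 κ₂), Finset.mul_sum]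
  refine Finset.sum_congr rfl fun κ₂ _ => ?_
  exact tsum_relabel_mul (rF κ₂)
    (fun z => (∑' x : Fin (d + 1) → ℤ, ∑ κ₁ : Fin (d + 1), l α x' κ₁ x * vertexW w S ν U x z (Sum.inl κ₁) (Sum.inl κ₂)) * r β z' κ₂ z)
    (fun z => (∑' x : Fin (d + 1) → ℤ, ∑ κ₁ : Fin (d + 1), l α (rC α x') κ₁ x * vertexW w S' ν (rC ν U) x z (Sum.inl κ₁) (Sum.inl κ₂)) * r β (rC β z') κ₂ z)
    _ (hzterm κ₂)

include hsF hl hr hw hS hws hls hrs in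
/-- NOT IN PRINT; OUR BOOKKEEPING.  **THE ff CHARGE PROFILE OF THE PUSHED FAMILY IS COVARIANT** (two more re-indexings of the output kernel indices, no further
summability): `Σ'_{x′} Σ'_{z′} push₃ l r w S′ ν (rC ν U) x′ z′ (inl α)(inl β) = sC ν·sC α·sC β·Σ'_{x′} Σ'_{z′} push₃ l r w S ν U x′ z′ (inl α)(inl β)` — the (S-τ)
recursion's input («an inversion-covariant letter family pushed through inversion-covariant legs has an inversion-covariant charge profile»; signs as displayed). -/
theorem tsum_tsum_push₃_relabel (ν : Fin (d + 1)) (U : Fin (d + 1) → ℤ) (α β : Fin (d + 1)) :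
    ∑' x' : Fin (d + 1) → ℤ, ∑' z' : Fin (d + 1) → ℤ, push₃ l r w S' ν (rC ν U) x' z' (Sum.inl α) (Sum.inl β)
      = sC ν * sC α * sC β * ∑' x' : Fin (d + 1) → ℤ, ∑' z' : Fin (d + 1) → ℤ, push₃ l r w S ν U x' z' (Sum.inl α) (Sum.inl β) := by
  refine tsum_relabel_mul (rC α) (fun x' => ∑' z' : Fin (d + 1) → ℤ, push₃ l r w S ν U x' z' (Sum.inl α) (Sum.inl β))
    (fun x' => ∑' z' : Fin (d + 1) → ℤ, push₃ l r w S' ν (rC ν U) x' z' (Sum.inl α) (Sum.inl β)) _ fun x' => ?_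
  exact tsum_relabel_mul (rC β) (fun z' => push₃ l r w S ν U x' z' (Sum.inl α) (Sum.inl β))
    (fun z' => push₃ l r w S' ν (rC ν U) (rC α x') z' (Sum.inl α) (Sum.inl β)) _ fun z' => push₃_relabel_inl_inl hsF hl hr hw hS hws hls hrs ν U x' z' α β

end Relabel

end Summit.QuantumFields.BalabanUV.Beta.GAN24.Push3Relabel

end
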